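import Summits.QuantumFields.BalabanUV.Beta.D1BFx.GhostQVertexDensity
import Summits.QuantumFields.BalabanUV.Beta.D1BFx.GhostRoadWordLetters
import Summits.QuantumFields.BalabanUV.Beta.D1BFx.GhostLegBlockMass
import Summits.QuantumFields.BalabanUV.Gaps.ProfileLegComposition

/-!
# `BalabanUV.Beta.D1BFx.GhostQWordLetters` — road «BF-x» for binder row D1, slot (K), GHOST-N8-SPEC v0.3 §3 (d3-Δ) LETTERS:
# **THE `Q′`-SIDE OF A ΔGH WORD IS A FLAT ONE-TERM MAJORANT `≲ n⁻⁸`, THE `K`-SIDE IS F1's TWO-TERM MAJORANT, AND THE `qSq` TADPOLE IS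
# `(block-row mass of the leg) × (n⁻¹² table) × (two-centre count n⁴)`**

HONEST DEPENDENCY (cell records, verbatim): «continuum YM on T⁴ ⇐ BetaPertH ∧ nine spine estimates (0/9 proved); BetaPertH ⇐ (D1) ∧ (D4) ∧
CAP+tail; G-an2-4 gates asym, D1 and NE2/3/4.»  HONEST FRAMING (cell contract, verbatim): «discharging `BetaPertH` makes Bałaban's UV stability
UNCONDITIONAL — a real constructive-QFT result; it is NOT the continuum limit and NOT the Clay problem.»  THIS MODULE DISCHARGES NOTHING of the
wall: [folklore] composition BY NAME of this lineage's L-Q′ (`GhostQVertexDensity`), F1 (`GhostVertexOrientation.abs_comp_gW_le`), F4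
(`GhostVertexDensities`), PART 1 (`ProfileWordCount.abs_tr_comp_le_of_majorant`), the g9 kit (`LatticeHLSRadial.sum_pow_mul_exp_scale_le`), gaps-g1-p1's
(C1) `Gaps.ProfileLegComposition.abs_comp_le_of_profiles_singular_flat_scale` and an3∕gan24-leaf-05's block-row mass `GhostLegBlockMass.sum_B_abs_Ggh_le`;
the leg letters of `Ggh` are DISPLAYED hypotheses (β2's shape).  No definition, no `def … : Prop`, nothing cited, 0 sorry.  0 root-level binders of row D1
discharged (hW ∕ hR-sockets ∕ hSX-socket ∕ D1Tel ∕ D1Rep = 0); (K) NOT closed; NOT D1, NOT `BetaPertH`, NOT continuum, NOT Clay.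

ABSOLUTE RULE (cell charter, verbatim): «No internally-minted statement may enter as a cited fact. Every hypothesis is either kernel-proved in
this package or a verbatim quotation of a PUBLISHED theorem with page reference. The manuscript(s) under audit are NOT citable for their own
disputed steps — they are the thing under adjudication; programme-internal (2001/route/tribunal) claims are never citable.»

WHY (GHOST-N8-SPEC v0.3 §3 (d3-Δ); journal ONLINE [D1LEAF04-G27-ONLINE], INTENT-2).  The four ΔGH words (`GhostDeltaWords.deltaGH_eq_words`) are
`bubble Ggh V_Q V_K`, `bubble Ggh V_K V_Q`, `bubble Ggh V_Q V_Q` and `−tadpole Ggh W_Q` with `V_Q := vertexRedF n (SghAt ρ n 0 cQ)`, `V_K := vertexRedF n (SghAt ρ n cK 0)`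
(`cK = n²` at the road's pin), `W_Q := tableRedF n (WghAt ρ n x₀ 0 cQ)`.  F2 (`OrientedProfileWords.decay510_biBubble_of_twoTerm`) prices a bubble from one
majorant per vertex side: §1 gives the `Q′`-side (a FLAT profile: the ghost leg `κ∕nrm²` composed with L-Q′'s block-local density `≲ |cQ|·n⁻⁸` is one
sub-critical block count `n²` — gaps' (C1) after dividing out the column's centre damping), §2 the `K`-side (F1 verbatim at the weights `cK·wH`).  §3 prices
the tadpole: the table is block-local with two-centre density `≲ n⁻¹²` (L-Q′), so `sup × cube` (F2 §4, which would spend `n²` too many) is replaced by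
the n-free BLOCK-ROW MASS of the leg.

CONTENT ([folklore]; `n = m + 1`, `N := (n : ℝ)`; `κ₄ := kappa163 4`, `M₅ := MG163 4·periodConst (kappa163 4) 3`, `M₆ := MD163 4·periodConst (kappa163 4) 3`;
`A_Q := 8·((N⁸)⁻¹·M₅·e^{κ₄∕4})·e^{κ₄∕4}` = L-Q′'s constant).
* §0 `comp_mulRight` (a right factor depending on the output site passes through `comp`).
* §1 **`abs_comp_Ggh_blockDensity_le`** (GENERIC: any kernel `V` with `|V p z| ≤ A·E_y(z)` supported on `blk p = blk z` behind a ghost-leg value letter ⟹ flat one-term majorant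
  `((C·A·e^{4δ})·(1 + 216·(4∕δ·(1+4∕δ)))∕nrm^0 + 0∕nrm^0)·e^{−(δ∕2∕N)‖x−z‖∞}·E_y(z)`); **`abs_comp_Ggh_VQ_le`**: value letter `|Ggh| ≤ (C∕N²)∕nrm²·e^{−(δ∕N)‖·‖∞}` + in-block root ⟹
  `|comp Ggh (V_Q μ y) x z| ≤ ((C·(|cQ|·(8·(M₅e^{κ₄∕4})·e^{κ₄∕4})·e^{4δ})·(1 + 216·(4∕δ·(1 + 4∕δ))))∕N⁸ ∕ nrm(x−z)^0 + 0∕nrm(x−z)^0)·e^{−(δ∕2∕N)‖x−z‖∞}·e^{−((κ₄∕16)∕N)‖z−N•y‖∞}`.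
* §2 **`abs_comp_Ggh_VK_le`**: value + right-difference letters ⟹ F1's two-term majorant (exponents `3`, `2`) at the weights `cK·wH`.
* §3 **`abs_tadpole_le_of_blockRow_blockTable`** (generic: leg with block-row mass `ML`, block-local two-centre table `A₂` ⟹ `|tadpole L W| ≤ |Unit|²·ML·A₂·K″(σ)·N⁴·e^{−(σ∕2∕N)‖C−C′‖∞}`),
  **`decay510_tadpole_Ggh_WQ`** (the instance, power `N⁴·N⁴·N⁻¹⁶`), **`decay510_tadpole_Ggh_WQ_pow`** (the same read as `K_T·(N⁸)⁻¹`).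
NOT HERE (honest): the rows (`RestKernelGhostDeltaSharp`); anything of the END.
Unit `b2b-balaban-beta-d1-formalise-leaf-04` (gen 27), D1 formalisation swarm, road «BF-x»; INTENT-2 [D1LEAF04-G27-INTENT-2]. Not in print; no existing file touched.
-/

noncomputable section

namespace Summit.QuantumFields.BalabanUV.Beta.D1BFx.GhostQWordLetters

open scoped BigOperators
open Finset
open Literature.MathematicalPhysics.QuantumFieldTheory.Balaban1983to89
open Literature.MathematicalPhysics.QuantumFieldTheory.Balaban1983to89.Beta
open B12Sec2to5 (l1 l1_nonneg Decay510)
open B5Hk163Strip (kappa163 kappa163_pos)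
open B5Hk163TorusHolderDecay (MD163)
open B5Hk163Decay (MG163)
open B4TorusKernel (periodConst)
open B6QGQLower276 (blk B mem_B)
open ExpKernelCalculus (Site MKer comp tr tadpole)
open AffineAveraging (unitVec)
open KernelSpecInstance (wH)
open PoissonInterior (supNorm nrm nrm_pos supNorm_add_le supNorm_neg)
open Summit.QuantumFields.BalabanUV.Beta.D1BFx.GhostLeg (Ggh)
open Summit.QuantumFields.BalabanUV.Beta.D1BFx.GhostStencil (ghCur l1_sub_le_of_blk_eq)
open Summit.QuantumFields.BalabanUV.Beta.D1BFx.GhostStencilRooted (SghAt)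
open Summit.QuantumFields.BalabanUV.Beta.D1BFx.GhostAveragingSquare (WghAt)
open Summit.QuantumFields.BalabanUV.Beta.D1BFx.ReducedKernelF (vertexRedF)
open Summit.QuantumFields.BalabanUV.Beta.D1BFx.ReducedTableF (tableRedF)
open Summit.QuantumFields.BalabanUV.Beta.D1BFx.GhostDeltaJetMasses (vertexRedF_SghAt_K)
open Summit.QuantumFields.BalabanUV.Beta.D1BFx.GhostVertexOrientation (smul_vertexRedF_ghCur_eq_gW abs_comp_gW_le)
open Summit.QuantumFields.BalabanUV.Beta.D1BFx.GhostVertexDensities (abs_ghostWeight_le abs_ghostWeight_sub_le cast_supNorm_le_l1)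
open Summit.QuantumFields.BalabanUV.Beta.D1BFx.ProfileWordCount (abs_tr_comp_le_of_majorant exp_centres_le)
open Summit.QuantumFields.BalabanUV.Beta.D1BFx.LatticeHLSRadial (sum_pow_mul_exp_scale_le)
open Summit.QuantumFields.BalabanUV.Beta.D1BFx.GhostLegBlockMass (cNear sum_B_abs_Ggh_le ghA0_pos)
open Summit.QuantumFields.BalabanUV.Beta.D1BFx.GhostLegFree (ghDelta_pos)
open Summit.QuantumFields.BalabanUV.Beta.D1BFx.GhostQVertexDensity (abs_vertexRedF_SghAt_Q_le vertexRedF_SghAt_Q_eq_zero_of_blk_ne abs_tableRedF_WghAt_Q_le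
  tableRedF_WghAt_Q_eq_zero_of_blk_ne)
open Summit.QuantumFields.BalabanUV.Gaps.ProfileLegComposition (abs_comp_le_of_profiles_singular_flat_scale)

/-! ## §0 A right factor depending on the output site passes through `comp` -/

/-- [folklore] `comp A (p z′ ↦ K p z′·c z′) x z = comp A K x z · c z` (the middle `tsum` and the fibre sum are linear). -/
theorem comp_mulRight {D : ℕ} {F : Type*} [Fintype F] (A K : MKer D F) (c : Site D → ℝ) (x z : Site D) (g f : F) :
    comp A (fun p z' h f' => K p z' h f' * c z') x z g f = comp A K x z g f * c z := by
  unfold ExpKernelCalculus.comp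
  rw [← tsum_mul_right]
  refine tsum_congr fun p => ?_
  rw [Finset.sum_mul]
  exact Finset.sum_congr rfl fun h _ => by ring

variable (m : ℕ) {a : ℝ}

/-! ## §1 The `Q′`-side: a flat one-term majorant `≲ n⁻⁸` -/

/-- [folklore] **A BLOCK-LOCAL CENTRED DENSITY BEHIND THE GHOST LEG IS A FLAT ONE-TERM MAJORANT** (generic vertex).  A ghost-leg VALUE letter
`|Ggh n a x y| ≤ (C∕N²)∕nrm(x−y)²·e^{−(δ∕N)‖x−y‖∞}` (`C ≥ 0`, `δ > 0`) and ANY kernel `V` with `|V p z| ≤ A·e^{−((κ₄∕16)∕N)‖z−N•y‖∞}` (`A ≥ 0`) and `V p z = 0` off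
`blk p = blk z` give, for every `x z`,
`|comp (Ggh n a) V x z| ≤ ((C·A·e^{4δ})·(1 + 216·(4∕δ·(1 + 4∕δ)))∕nrm(x−z)^0 + 0∕nrm(x−z)^0)·e^{−(δ∕2∕N)‖x−z‖∞}·e^{−((κ₄∕16)∕N)‖z−N•y‖∞}` — the density with the
centre damping divided out is a FLAT damped factor (`e^{4δ}`: block-mates are `≤ 4N` apart), gaps' (C1) at scale counts the one block (`N²`, cancelling the leg's `N⁻²`),
`comp_mulRight` restores the damping.  (The `Q′`-vertex below and C2's frozen-averaging commutators `[P_a, χ̂]` are both of this shape.) -/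
theorem abs_comp_Ggh_blockDensity_le {C δ : ℝ} (hC : 0 ≤ C) (hδ : 0 < δ)
    (hG : ∀ x y : Site 4, |Ggh (m + 1) a x y () ()| ≤ (C / (((m + 1 : ℕ) : ℝ)) ^ 2) / nrm (x - y) ^ 2 * Real.exp (-(δ / ((m + 1 : ℕ) : ℝ)) * supNorm (x - y)))
    {V : MKer 4 Unit} {A : ℝ} (hA : 0 ≤ A) {y : Site 4}
    (hV : ∀ (p z : Site 4) (h f : Unit), |V p z h f| ≤ A * Real.exp (-(kappa163 4 / 16 / ((m + 1 : ℕ) : ℝ)) * supNorm (z - ((m + 1 : ℕ) : ℤ) • y)))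
    (hVb : ∀ (p z : Site 4) (h f : Unit), blk (m + 1 - 1) p ≠ blk (m + 1 - 1) z → V p z h f = 0)
    (x z : Site 4) (g f : Unit) :
    |comp (Ggh (m + 1) a) V x z g f|
      ≤ ((C * A * Real.exp (4 * δ)) * (1 + 216 * (4 / δ * (1 + 4 / δ))) / nrm (x - z) ^ 0 + 0 / nrm (x - z) ^ 0)
        * Real.exp (-(δ / 2 / ((m + 1 : ℕ) : ℝ)) * supNorm (x - z))
        * Real.exp (-(kappa163 4 / 16 / ((m + 1 : ℕ) : ℝ)) * supNorm (z - ((m + 1 : ℕ) : ℤ) • y)) := by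
  have hn : 1 ≤ m + 1 := Nat.le_add_left 1 m
  have hN0 : (0 : ℝ) < ((m + 1 : ℕ) : ℝ) := by exact_mod_cast Nat.succ_pos m
  -- the column's centre damping on the OUTPUT site
  obtain ⟨E, hE⟩ : ∃ E : Site 4 → ℝ, E = fun z' => Real.exp (-(kappa163 4 / 16 / ((m + 1 : ℕ) : ℝ)) * supNorm (z' - ((m + 1 : ℕ) : ℤ) • y)) := ⟨_, rfl⟩
  have hEpos : ∀ z', 0 < E z' := fun z' => by rw [hE]; exact Real.exp_pos _
  -- the vertex with the damping divided out is a FLAT damped kernel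
  obtain ⟨K₂, hK₂⟩ : ∃ K₂ : MKer 4 Unit, K₂ = fun p z' h f' => V p z' h f' * (E z')⁻¹ := ⟨_, rfl⟩
  have hVK : V = fun p z' h f' => K₂ p z' h f' * E z' := by
    funext p z' h f'
    rw [hK₂, inv_mul_cancel_right₀ (hEpos z').ne']
  have hK₂flat : ∀ (p z' : Site 4) (h f' : Unit), |K₂ p z' h f'| ≤ A * Real.exp (4 * δ) * Real.exp (-(δ / ((m + 1 : ℕ) : ℝ)) * supNorm (p - z')) := by
    intro p z' h f'
    rw [hK₂]
    simp only
    rw [abs_mul, abs_inv, abs_of_pos (hEpos z')]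
    by_cases hb : blk (m + 1 - 1) p = blk (m + 1 - 1) z'
    · have h2 : |V p z' h f'| * (E z')⁻¹ ≤ A := by
        rw [mul_inv_le_iff₀ (hEpos z'), hE]
        exact hV p z' h f'
      have h3 : 1 ≤ Real.exp (4 * δ) * Real.exp (-(δ / ((m + 1 : ℕ) : ℝ)) * supNorm (p - z')) := by
        rw [← Real.exp_add]
        apply Real.one_le_exp
        have hs : (supNorm (p - z') : ℝ) ≤ 4 * ((m + 1 : ℕ) : ℝ) := (cast_supNorm_le_l1 _).trans (l1_sub_le_of_blk_eq (m + 1) hb)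
        have hδN : 0 ≤ δ / ((m + 1 : ℕ) : ℝ) := by positivity
        have e4 : δ / ((m + 1 : ℕ) : ℝ) * (4 * ((m + 1 : ℕ) : ℝ)) = 4 * δ := by field_simp
        nlinarith [mul_le_mul_of_nonneg_left hs hδN]
      calc |V p z' h f'| * (E z')⁻¹ ≤ A := h2
        _ ≤ A * (Real.exp (4 * δ) * Real.exp (-(δ / ((m + 1 : ℕ) : ℝ)) * supNorm (p - z'))) := le_mul_of_one_le_right hA h3
        _ = _ := by ring
    · rw [hVb p z' h f' hb, abs_zero, zero_mul]; positivity
  -- gaps' (C1) at scale: singular (exponent 2) × flat ⟹ flat, rate halved, one block counted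
  have hcomp := abs_comp_le_of_profiles_singular_flat_scale (d := 4) (F := Unit) (by norm_num) (a := 2) (by norm_num) hδ hn
    (K₁ := Ggh (m + 1) a) (K₂ := K₂) (κ₁ := C / (((m + 1 : ℕ) : ℝ)) ^ 2) (κ₂ := A * Real.exp (4 * δ)) (by positivity) (by positivity)
    (fun x' y' g' h' => by obtain ⟨⟩ := g'; obtain ⟨⟩ := h'; exact hG x' y') hK₂flat x z g f
  rw [hVK, comp_mulRight, abs_mul, abs_of_pos (hEpos z), zero_div, add_zero, hE]
  refine (mul_le_mul_of_nonneg_right hcomp (Real.exp_pos _).le).trans (le_of_eq ?_)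
  rw [Fintype.card_unit]
  simp only [Nat.cast_one, one_mul, pow_zero, div_one, show (4 : ℕ) - 1 - 2 = 1 from rfl, show (4 : ℕ) - 2 = 2 from rfl, show (4 : ℕ) - 1 = 3 from rfl,
    Nat.factorial_one, pow_one, Nat.cast_ofNat]
  field_simp
  ring

/-- [folklore] **THE `Q′`-SIDE MAJORANT.**  For an in-block root, a ghost-leg VALUE letter `|Ggh n a x y| ≤ (C∕N²)∕nrm(x−y)²·e^{−(δ∕N)‖x−y‖∞}` (`C ≥ 0`, `δ > 0`)
and every `cQ μ y x z`:
`|comp (Ggh n a) (vertexRedF n (SghAt ρ n 0 cQ) μ y) x z| ≤ (c_Q∕N⁸∕nrm(x−z)^0 + 0∕nrm(x−z)^0)·e^{−(δ∕2∕N)‖x−z‖∞}·e^{−((κ₄∕16)∕N)‖z−N•y‖∞}`,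
`c_Q = C·(|cQ|·(8·(M₅e^{κ₄∕4})·e^{κ₄∕4})·e^{4δ})·(1 + 216·(4∕δ·(1 + 4∕δ)))` — `abs_comp_Ggh_blockDensity_le` at L-Q′'s letters (`abs_vertexRedF_SghAt_Q_le`,
`vertexRedF_SghAt_Q_eq_zero_of_blk_ne`). -/
theorem abs_comp_Ggh_VQ_le {ρ : Site 4} (hρ : ∀ i : Fin 4, 0 ≤ ρ i ∧ ρ i < (m + 1 : ℕ)) {C δ : ℝ} (hC : 0 ≤ C) (hδ : 0 < δ)
    (hG : ∀ x y : Site 4, |Ggh (m + 1) a x y () ()| ≤ (C / (((m + 1 : ℕ) : ℝ)) ^ 2) / nrm (x - y) ^ 2 * Real.exp (-(δ / ((m + 1 : ℕ) : ℝ)) * supNorm (x - y)))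
    (cQ : ℝ) (μ : Fin 4) (y x z : Site 4) (g f : Unit) :
    |comp (Ggh (m + 1) a) (vertexRedF (m + 1) (SghAt ρ (m + 1) 0 cQ) μ y) x z g f|
      ≤ ((C * (|cQ| * (8 * ((MG163 4 * periodConst (kappa163 4) 3) * Real.exp (kappa163 4 / 4)) * Real.exp (kappa163 4 / 4)) * Real.exp (4 * δ))
            * (1 + 216 * (4 / δ * (1 + 4 / δ)))) / (((m + 1 : ℕ) : ℝ)) ^ 8 / nrm (x - z) ^ 0 + 0 / nrm (x - z) ^ 0)
        * Real.exp (-(δ / 2 / ((m + 1 : ℕ) : ℝ)) * supNorm (x - z))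
        * Real.exp (-(kappa163 4 / 16 / ((m + 1 : ℕ) : ℝ)) * supNorm (z - ((m + 1 : ℕ) : ℤ) • y)) := by
  have hN0 : (0 : ℝ) < ((m + 1 : ℕ) : ℝ) := by exact_mod_cast Nat.succ_pos m
  have hAQ0 : 0 ≤ |cQ| * (8 * ((((m + 1 : ℕ) : ℝ) ^ 8)⁻¹ * (MG163 4 * periodConst (kappa163 4) 3) * Real.exp (kappa163 4 / 4)) * Real.exp (kappa163 4 / 4)) := by
    have h := abs_vertexRedF_SghAt_Q_le m hρ cQ μ y (((m + 1 : ℕ) : ℤ) • y) (((m + 1 : ℕ) : ℤ) • y) () ()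
    rw [sub_self, show supNorm (0 : Site 4) = 0 from by simp [PoissonInterior.supNorm], Nat.cast_zero, mul_zero, Real.exp_zero, mul_one] at h
    exact (abs_nonneg _).trans h
  have h := abs_comp_Ggh_blockDensity_le m hC hδ hG hAQ0 (fun p z' h' f' => abs_vertexRedF_SghAt_Q_le m hρ cQ μ y p z' h' f')
    (fun p z' h' f' hb => vertexRedF_SghAt_Q_eq_zero_of_blk_ne m ρ cQ μ y hb h' f') x z g f
  refine h.trans (le_of_eq ?_)
  simp only [pow_zero, div_one, add_zero]
  field_simp

/-! ## §2 The `K`-side: F1's two-term majorant at the weights `cK·wH` -/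

/-- [folklore] **THE `K`-SIDE MAJORANT** (any root; F1 `abs_comp_gW_le` at F4's densities with `c = cK`): VALUE letter (exponent `2`) and RIGHT-DIFFERENCE
letter (exponent `3`) of `Ggh` at rate `δ ≥ 0`, constant `C∕N²`, give
`|comp (Ggh n a) (vertexRedF n (SghAt ρ n cK 0) ν y) x z| ≤ (4(1+2³e^δ)·(|cK|·((N⁵)⁻¹M₅e^{κ₄∕4}))·(C∕N²)∕nrm(x−z)³ + 4·2²·e^δ·(|cK|·((N⁶)⁻¹(M₆e^{κ₄∕4})e^{κ₄∕16}))·(C∕N²)∕nrm(x−z)²)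
  · e^{−(δ∕N)‖x−z‖∞}·e^{−((κ₄∕16)∕N)‖z−N•y‖∞}`. -/
theorem abs_comp_Ggh_VK_le (ρ : Site 4) {C δ : ℝ} (hC : 0 ≤ C) (hδ : 0 ≤ δ)
    (hG0 : ∀ x y : Site 4, |Ggh (m + 1) a x y () ()| ≤ (C / (((m + 1 : ℕ) : ℝ)) ^ 2) / nrm (x - y) ^ 2 * Real.exp (-(δ / ((m + 1 : ℕ) : ℝ)) * supNorm (x - y)))
    (hG2 : ∀ (x y : Site 4) (μ : Fin 4), |Ggh (m + 1) a x (y + unitVec μ) () () - Ggh (m + 1) a x y () ()|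
      ≤ (C / (((m + 1 : ℕ) : ℝ)) ^ 2) / nrm (x - y) ^ 3 * Real.exp (-(δ / ((m + 1 : ℕ) : ℝ)) * supNorm (x - y)))
    (cK : ℝ) (ν : Fin 4) (y x z : Site 4) (g f : Unit) :
    |comp (Ggh (m + 1) a) (vertexRedF (m + 1) (SghAt ρ (m + 1) cK 0) ν y) x z g f|
      ≤ (4 * (1 + 2 ^ 3 * Real.exp δ) * (|cK| * ((((m + 1 : ℕ) : ℝ) ^ 5)⁻¹ * (MG163 4 * periodConst (kappa163 4) 3) * Real.exp (kappa163 4 / 4)))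
            * (C / (((m + 1 : ℕ) : ℝ)) ^ 2) / nrm (x - z) ^ 3
          + 4 * 2 ^ 2 * Real.exp δ * (|cK| * ((((m + 1 : ℕ) : ℝ) ^ 6)⁻¹ * ((MD163 4 * periodConst (kappa163 4) 3) * Real.exp (kappa163 4 / 4)) * Real.exp (kappa163 4 / 16)))
            * (C / (((m + 1 : ℕ) : ℝ)) ^ 2) / nrm (x - z) ^ 2)
        * Real.exp (-(δ / ((m + 1 : ℕ) : ℝ)) * supNorm (x - z))
        * Real.exp (-(kappa163 4 / 16 / ((m + 1 : ℕ) : ℝ)) * supNorm (z - ((m + 1 : ℕ) : ℤ) • y)) := by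
  have hn : 1 ≤ m + 1 := Nat.le_add_left 1 m
  have hC' : 0 ≤ C / (((m + 1 : ℕ) : ℝ)) ^ 2 := by positivity
  rw [vertexRedF_SghAt_K ρ (m + 1) cK ν y, smul_vertexRedF_ghCur_eq_gW]
  exact abs_comp_gW_le hn hC' hC' hδ hG0 hG2 (fun κ z => abs_ghostWeight_le m cK ν y κ z) (fun κ z => abs_ghostWeight_sub_le m cK ν y κ z) x z g f

/-! ## §3 The tadpole: block-row mass of the leg × block-local two-centre table × two-centre count -/

/-- [folklore] **TADPOLE WITH A BLOCK-LOCAL TWO-CENTRE TABLE AGAINST A LEG OF BOUNDED BLOCK-ROW MASS** (`Unit` fibre, `N ≥ 1`):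
`Σ_{z ∈ B β} |L x z| ≤ ML` for every `x β`, `|W z x| ≤ A₂·e^{−(σ∕N)‖x−C‖∞}·e^{−(σ∕N)‖x−C′‖∞}`, `W z x = 0` unless `blk z = blk x` (`ML, A₂ ≥ 0`, `σ > 0`) ⟹
`|tadpole L W| ≤ |Unit|²·(ML·A₂·(1 + 2·4·3³·(3!·(4∕σ)³·(1+4∕σ)))·N⁴·e^{−(σ∕2∕N)‖C−C′‖∞})` — PART 1's `abs_tr_comp_le_of_majorant` with the row mass in `z`
and the g9 kit's centre count in `x` (F2 §4's pattern with the cube replaced by the block). -/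
theorem abs_tadpole_le_of_blockRow_blockTable {n : ℕ} (hn : 1 ≤ n) {L W : MKer 4 Unit} {ML A₂ σ : ℝ} {C C' : Site 4}
    (hML : 0 ≤ ML) (hA₂ : 0 ≤ A₂) (hσ : 0 < σ)
    (hL : ∀ x β : Site 4, ∑ z ∈ B (n - 1) β, |L x z () ()| ≤ ML)
    (hW : ∀ (z x : Site 4) (f g : Unit), |W z x f g| ≤ A₂ * Real.exp (-(σ / n) * supNorm (x - C)) * Real.exp (-(σ / n) * supNorm (x - C')))
    (hWb : ∀ (z x : Site 4) (f g : Unit), blk (n - 1) z ≠ blk (n - 1) x → W z x f g = 0) :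
    |tadpole L W| ≤ (Fintype.card Unit : ℝ) ^ 2 *
      (ML * A₂ * (1 + 2 * (4 : ℕ) * 3 ^ ((4 : ℕ) - 1) * (((4 : ℕ) - 1).factorial * (4 / σ) ^ ((4 : ℕ) - 1) * (1 + 4 / σ))) * (n : ℝ) ^ 4
        * Real.exp (-(σ / 2 / n) * supNorm (C - C'))) := by
  classical
  have hn0 : (0 : ℝ) < n := by exact_mod_cast hn
  have hσn : 0 ≤ σ / n := by positivity
  -- the block-restricted table majorant
  let M₂ : Site 4 → Site 4 → ℝ := fun z x =>
    if blk (n - 1) z = blk (n - 1) x then A₂ * Real.exp (-(σ / n) * supNorm (x - C)) * Real.exp (-(σ / n) * supNorm (x - C')) else 0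
  have hM₂ : ∀ z x f g, |W z x f g| ≤ M₂ z x := by
    intro z x f g
    by_cases h : blk (n - 1) z = blk (n - 1) x
    · simp only [M₂, if_pos h]; exact hW z x f g
    · simp only [M₂, if_neg h]; rw [hWb z x f g h, abs_zero]
  have hM₂0 : ∀ z x, 0 ≤ M₂ z x := fun z x => by
    simp only [M₂]; split_ifs <;> positivity
  unfold ExpKernelCalculus.tadpole
  refine abs_tr_comp_le_of_majorant (M₁ := fun x z => |L x z () ()|) (M₂ := M₂)
    (fun x z g f => by obtain ⟨⟩ := g; obtain ⟨⟩ := f; exact le_rfl) hM₂ (fun _ _ => abs_nonneg _) hM₂0 fun S T => ?_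
  -- the `z`-sum: the block row of `x`
  have hinner : ∀ x, ∑ z ∈ T, |L x z () ()| * M₂ z x
      ≤ ML * (A₂ * Real.exp (-(σ / n) * supNorm (x - C)) * Real.exp (-(σ / n) * supNorm (x - C'))) := by
    intro x
    have e : ∑ z ∈ T, |L x z () ()| * M₂ z x = (∑ z ∈ T.filter (fun z => blk (n - 1) z = blk (n - 1) x), |L x z () ()|)
        * (A₂ * Real.exp (-(σ / n) * supNorm (x - C)) * Real.exp (-(σ / n) * supNorm (x - C'))) := by
      rw [Finset.sum_filter, Finset.sum_mul]
      refine Finset.sum_congr rfl fun z _ => ?_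
      simp only [M₂]
      split_ifs <;> simp
    rw [e]
    refine mul_le_mul_of_nonneg_right ?_ (by positivity)
    calc ∑ z ∈ T.filter (fun z => blk (n - 1) z = blk (n - 1) x), |L x z () ()| ≤ ∑ z ∈ B (n - 1) (blk (n - 1) x), |L x z () ()| :=
          Finset.sum_le_sum_of_subset_of_nonneg (fun z hz => by rw [Finset.mem_filter] at hz; exact mem_B.2 hz.2) (fun _ _ _ => abs_nonneg _)
      _ ≤ ML := hL x _
  -- the `x`-sum: the two-centre count
  have hcount : ∑ x ∈ S, ((supNorm (x - C) : ℕ) : ℝ) ^ 0 * Real.exp (-(σ / 2 / n) * supNorm (x - C))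
      ≤ (1 + 2 * (4 : ℕ) * 3 ^ ((4 : ℕ) - 1) * (((4 : ℕ) - 1).factorial * (4 / σ) ^ ((4 : ℕ) - 1) * (1 + 4 / σ))) * (n : ℝ) ^ 4 := by
    have h := sum_pow_mul_exp_scale_le (d := 4) (by norm_num) (half_pos hσ) hn 0 S C
    have e4 : (2 : ℝ) / (σ / 2) = 4 / σ := by field_simp; ring
    rw [zero_add, e4] at h
    refine h.trans ?_
    have hn1 : (1 : ℝ) ≤ n := by exact_mod_cast hn
    have hnD : (1 : ℝ) ≤ (n : ℝ) ^ 4 := one_le_pow₀ hn1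
    have hc0 : (0 : ℝ) ≤ 2 * (4 : ℕ) * 3 ^ ((4 : ℕ) - 1) * (((4 : ℕ) - 1).factorial * (4 / σ) ^ ((4 : ℕ) - 1) * (1 + 4 / σ)) := by positivity
    nlinarith [mul_nonneg hc0 (le_trans zero_le_one hnD)]
  have hhalf : ∀ x, Real.exp (-(σ / n) * supNorm (x - C)) * Real.exp (-(σ / n) * supNorm (x - C'))
      ≤ Real.exp (-(σ / 2 / n) * supNorm (C - C')) * Real.exp (-(σ / 2 / n) * supNorm (x - C)) := by
    intro x
    have htri : supNorm (C - C') ≤ supNorm (x - C) + supNorm (x - C') := by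
      have h1 := supNorm_add_le (C - x) (x - C')
      rw [show C - x + (x - C') = C - C' by abel, show C - x = -(x - C) by abel, supNorm_neg] at h1
      exact h1
    have htri' : (supNorm (C - C') : ℝ) ≤ supNorm (x - C) + supNorm (x - C') := by exact_mod_cast htri
    have t1 : (0 : ℝ) ≤ supNorm (x - C') := Nat.cast_nonneg _
    rw [← Real.exp_add, ← Real.exp_add]
    apply Real.exp_le_exp.mpr
    have e1 : σ / 2 / (n : ℝ) = (σ / n) / 2 := by ring
    rw [e1]
    nlinarith [mul_nonneg hσn t1]
  calc ∑ x ∈ S, ∑ z ∈ T, |L x z () ()| * M₂ z x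
      ≤ ∑ x ∈ S, ML * (A₂ * Real.exp (-(σ / n) * supNorm (x - C)) * Real.exp (-(σ / n) * supNorm (x - C'))) :=
        Finset.sum_le_sum fun x _ => hinner x
    _ ≤ ∑ x ∈ S, ML * (A₂ * (Real.exp (-(σ / 2 / n) * supNorm (C - C')) * Real.exp (-(σ / 2 / n) * supNorm (x - C)))) := by
        refine Finset.sum_le_sum fun x _ => ?_
        have := hhalf x
        have h0 : 0 ≤ ML * A₂ := by positivity
        calc ML * (A₂ * Real.exp (-(σ / n) * supNorm (x - C)) * Real.exp (-(σ / n) * supNorm (x - C')))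
            = ML * A₂ * (Real.exp (-(σ / n) * supNorm (x - C)) * Real.exp (-(σ / n) * supNorm (x - C'))) := by ring
          _ ≤ ML * A₂ * (Real.exp (-(σ / 2 / n) * supNorm (C - C')) * Real.exp (-(σ / 2 / n) * supNorm (x - C))) :=
              mul_le_mul_of_nonneg_left this h0
          _ = _ := by ring
    _ = ML * A₂ * Real.exp (-(σ / 2 / n) * supNorm (C - C'))
        * ∑ x ∈ S, ((supNorm (x - C) : ℕ) : ℝ) ^ 0 * Real.exp (-(σ / 2 / n) * supNorm (x - C)) := by
        rw [Finset.mul_sum]; refine Finset.sum_congr rfl fun x _ => ?_; rw [pow_zero]; ring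
    _ ≤ ML * A₂ * Real.exp (-(σ / 2 / n) * supNorm (C - C'))
        * ((1 + 2 * (4 : ℕ) * 3 ^ ((4 : ℕ) - 1) * (((4 : ℕ) - 1).factorial * (4 / σ) ^ ((4 : ℕ) - 1) * (1 + 4 / σ))) * (n : ℝ) ^ 4) :=
        mul_le_mul_of_nonneg_left hcount (by positivity)
    _ = _ := by ring

/-- [folklore] The block-row mass constant of the ghost leg is positive. -/
theorem cNear_pos (ha : 0 < a) : 0 < cNear a := by
  unfold cNear
  have := ghA0_pos ha; have := ghDelta_pos ha; have := lt_min (two_pos : (0:ℝ) < 2) ha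
  positivity

/-- [folklore] **THE `qSq` TADPOLE OF ΔGH AS A (5.10)-KERNEL** (in-block root, `0 < a`; block-row mass `cNear a` of `Ggh` by `GhostLegBlockMass.sum_B_abs_Ggh_le`,
table `≲ |x₀||cQ|·N⁴·A_Q²` by L-Q′): `Decay510 (z ↦ tadpole (Ggh n a) (tableRedF n (WghAt ρ n x₀ 0 cQ) μ 0 ν z)) (|Unit|²·(cNear a·(|x₀|·|cQ|·N⁴·A_Q²)·K″(κ₄∕16)·N⁴)) ((κ₄∕16)∕2∕4)`. -/
theorem decay510_tadpole_Ggh_WQ {ρ : Site 4} (hρ : ∀ i : Fin 4, 0 ≤ ρ i ∧ ρ i < (m + 1 : ℕ)) (ha : 0 < a) (x₀ cQ : ℝ) (μ ν : Fin 4) :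
    Decay510 (fun z => tadpole (Ggh (m + 1) a) (tableRedF (m + 1) (WghAt ρ (m + 1) x₀ 0 cQ) μ 0 ν z))
      ((Fintype.card Unit : ℝ) ^ 2 *
        (cNear a * (|x₀| * |cQ| * (((m + 1 : ℕ) : ℝ)) ^ 4
            * (8 * ((((m + 1 : ℕ) : ℝ) ^ 8)⁻¹ * (MG163 4 * periodConst (kappa163 4) 3) * Real.exp (kappa163 4 / 4)) * Real.exp (kappa163 4 / 4)) ^ 2)
          * (1 + 2 * (4 : ℕ) * 3 ^ ((4 : ℕ) - 1) * (((4 : ℕ) - 1).factorial * (4 / (kappa163 4 / 16)) ^ ((4 : ℕ) - 1) * (1 + 4 / (kappa163 4 / 16))))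
          * (((m + 1 : ℕ) : ℝ)) ^ 4))
      (kappa163 4 / 16 / 2 / (4 : ℕ)) := by
  have hn : 1 ≤ m + 1 := Nat.le_add_left 1 m
  have hσ : 0 < kappa163 4 / 16 := by have := kappa163_pos 4; positivity
  have hML : 0 ≤ cNear a := (cNear_pos ha).le
  have hA₂ : 0 ≤ |x₀| * |cQ| * (((m + 1 : ℕ) : ℝ)) ^ 4
      * (8 * ((((m + 1 : ℕ) : ℝ) ^ 8)⁻¹ * (MG163 4 * periodConst (kappa163 4) 3) * Real.exp (kappa163 4 / 4)) * Real.exp (kappa163 4 / 4)) ^ 2 := by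
    positivity
  have hL : ∀ x β : Site 4, ∑ z ∈ B (m + 1 - 1) β, |Ggh (m + 1) a x z () ()| ≤ cNear a := by
    intro x β
    refine (sum_B_abs_Ggh_le (m + 1) ha x β).trans ?_
    refine mul_le_of_le_one_right hML (Real.exp_le_one_iff.2 ?_)
    have := ghDelta_pos ha
    have : 0 ≤ dist (blk (m + 1 - 1) x) β := dist_nonneg
    nlinarith
  intro z
  have h := abs_tadpole_le_of_blockRow_blockTable hn (L := Ggh (m + 1) a) (W := tableRedF (m + 1) (WghAt ρ (m + 1) x₀ 0 cQ) μ 0 ν z)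
    (C := ((m + 1 : ℕ) : ℤ) • (0 : Site 4)) (C' := ((m + 1 : ℕ) : ℤ) • z) hML hA₂ hσ hL
    (fun z' x f g => abs_tableRedF_WghAt_Q_le m hρ x₀ cQ μ 0 ν z z' x f g)
    (fun z' x f g hb => tableRedF_WghAt_Q_eq_zero_of_blk_ne m ρ x₀ cQ μ 0 ν z hb f g)
  refine h.trans ?_
  have hc := exp_centres_le (D := 4) (by norm_num) hn (half_pos hσ).le z
  have hK : 0 ≤ (Fintype.card Unit : ℝ) ^ 2 *
        (cNear a * (|x₀| * |cQ| * (((m + 1 : ℕ) : ℝ)) ^ 4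
            * (8 * ((((m + 1 : ℕ) : ℝ) ^ 8)⁻¹ * (MG163 4 * periodConst (kappa163 4) 3) * Real.exp (kappa163 4 / 4)) * Real.exp (kappa163 4 / 4)) ^ 2)
          * (1 + 2 * (4 : ℕ) * 3 ^ ((4 : ℕ) - 1) * (((4 : ℕ) - 1).factorial * (4 / (kappa163 4 / 16)) ^ ((4 : ℕ) - 1) * (1 + 4 / (kappa163 4 / 16))))
          * (((m + 1 : ℕ) : ℝ)) ^ 4) := by
    positivity
  calc _ = (Fintype.card Unit : ℝ) ^ 2 *
        (cNear a * (|x₀| * |cQ| * (((m + 1 : ℕ) : ℝ)) ^ 4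
            * (8 * ((((m + 1 : ℕ) : ℝ) ^ 8)⁻¹ * (MG163 4 * periodConst (kappa163 4) 3) * Real.exp (kappa163 4 / 4)) * Real.exp (kappa163 4 / 4)) ^ 2)
          * (1 + 2 * (4 : ℕ) * 3 ^ ((4 : ℕ) - 1) * (((4 : ℕ) - 1).factorial * (4 / (kappa163 4 / 16)) ^ ((4 : ℕ) - 1) * (1 + 4 / (kappa163 4 / 16))))
          * (((m + 1 : ℕ) : ℝ)) ^ 4)
        * Real.exp (-(kappa163 4 / 16 / 2 / ((m + 1 : ℕ) : ℝ)) * supNorm (((m + 1 : ℕ) : ℤ) • (0 : Site 4) - ((m + 1 : ℕ) : ℤ) • z)) := by ring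
    _ ≤ _ := mul_le_mul_of_nonneg_left hc hK

/-- [folklore] **… IN THE `n⁻⁸` CURRENCY**: the same kernel with the constant read as `(|Unit|²·cNear a·|x₀|·|cQ|·64·(M₅e^{κ₄∕4}·e^{κ₄∕4})²·K″(κ₄∕16))·(N⁸)⁻¹`
(`N⁴·N⁴·(N⁸)⁻² = (N⁸)⁻¹`). -/
theorem decay510_tadpole_Ggh_WQ_pow {ρ : Site 4} (hρ : ∀ i : Fin 4, 0 ≤ ρ i ∧ ρ i < (m + 1 : ℕ)) (ha : 0 < a) (x₀ cQ : ℝ) (μ ν : Fin 4) :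
    Decay510 (fun z => tadpole (Ggh (m + 1) a) (tableRedF (m + 1) (WghAt ρ (m + 1) x₀ 0 cQ) μ 0 ν z))
      (((Fintype.card Unit : ℝ) ^ 2 *
        (cNear a * (|x₀| * |cQ| * (64 * ((MG163 4 * periodConst (kappa163 4) 3) * Real.exp (kappa163 4 / 4) * Real.exp (kappa163 4 / 4)) ^ 2))
          * (1 + 2 * (4 : ℕ) * 3 ^ ((4 : ℕ) - 1) * (((4 : ℕ) - 1).factorial * (4 / (kappa163 4 / 16)) ^ ((4 : ℕ) - 1) * (1 + 4 / (kappa163 4 / 16))))))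
        * ((((m + 1 : ℕ) : ℝ)) ^ 8)⁻¹)
      (kappa163 4 / 16 / 2 / (4 : ℕ)) := by
  have hN0 : (0 : ℝ) < ((m + 1 : ℕ) : ℝ) := by exact_mod_cast Nat.succ_pos m
  refine ExpKernelCalculus.decay510_mono_const (decay510_tadpole_Ggh_WQ m hρ ha x₀ cQ μ ν) (le_of_eq ?_)
  field_simp
  ring

end Summit.QuantumFields.BalabanUV.Beta.D1BFx.GhostQWordLetters

end
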